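import Summits.AtomisticToContinuum.Crystallization.Theorems.FrustratedLawDichotomyStrainedPatchHomEntryFitHcpFatLeaf

/-!
# The CONE LEAF (node 89 V-c ∘ V-b / node 90 PT-3, second kind): ONE thin robust fit certificate certifies every DILATE `s • (thin box)`,
# `1 ≤ s ≤ 3/(2(d_hi + ρ))`, each with its `s·ρ` ξ-collar, in the quotient currency

decomp-a2c hand-2 g41 — structural share for the crux `AperiodicFrustratedLawGap` (stmt-AtomisticToContinuum-27623; `(H) HomFloor`, hcp half).
The fat leaf of record (`…HomEntryFitHcpFatLeaf`, p854329/p854340) is the bookkeeping over `hcpLeafGoal_of_collar_coord` — the `s = 1` SLICE of the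
most general landed transfer theorem of lens-5's NODE 90, `…HomParamTransfer.hcpLeafGoal_of_cone_collar` («collars and cones COMPOSE on ONE base
certificate»; critic rows 1527/1531/1536: «V-c stays a conditional prize», FATPRICE-90 cone ×0.85 on the T book).  This file is the port of that
general theorem — «the most general landed lemma first, then specialise»:

THE LEAF.  Data: a THIN box `(c₀, w₀)`, a rotation index `q`, a collar radius `ρS`, a residual budget `e0S` (as for the fat leaf), and PER CELL a
rational dilation `s = sN/sD` (`0 < sD ≤ sN`) and a leaf box `(c, w)`.  The Boolean `coneLeafOK c₀ w₀ q ρS e0S sN sD c w` checks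
(i)  `uConeContained sN sD c₀ w₀ c w`: the nine `U`-entry intervals of `(c, w)` SHRUNK BY `s⁻¹` lie inside those of `(c₀, w₀)`
     (`sN·(c₀ − w₀) ≤ sD·(c − w)` and `sD·(c + w) ≤ sN·(c₀ + w₀)`, integers);
(ii) `xiConeCollarOK sN sD c₀ w₀ ρS c w`: `0 ≤ w₀` on the shuffle coordinates and `25·sD²·Σᵢ Δᵢ² ≤ 16·sN²·ρS²`, `Δᵢ` the fat leaf's `xiDelta`
     (i.e. `(5/4)·√(Σ Δᵢ²) ≤ s·ρS`: the collar DILATES with the cell);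
(iii) `coneDilationOK sN sD hi ρS` with `hi := (dEnclH c₀ w₀).hi`: `0 < sD ≤ sN` and `2·sN·(hi + ρS) ≤ 3·SC·sD` (i.e. `s·(d_hi + ρ) ≤ 3/2`);
(iv) `fitOKHDCRSρ c₀ w₀ q ρS e0S`: the robust fit certificate on the THIN box (unchanged).
Soundness `semOKHQ_of_coneLeafOK`: then `semOKHQ μ c w = true` at EVERY level `μ` — for `(U', ξ')` in the cell, the base `U := s⁻¹ • U'` lies in
the thin `U`-box, is self-adjoint with `U'`, carries the robust package by `fitOKHDCRSρ_sound`, and `hcpLeafGoal_of_cone_collar` at the clamp of `ξ'`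
into the thin shuffle box (the fat leaf's `clamp_spec`) gives the goal at `s • U = U'`; the window clauses are those of the ACTUAL `(U', ξ')` only.
§4: ONE thin certificate + a LIST of cheap cone cells `(sN, sD, c, w)` (`coneLeavesOK`, `semFactsQ_of_coneLeavesOK`; the thin certificate and `dEnclH`
evaluated ONCE) — cone cells enter the manifests of record as LISTED facts exactly like fat cells.  §5: at `sN = sD` the cone cell test is the fat
cell test plus (iii) (`coneCellOK_self_iff`), so the fat leaf is the `s = 1` slice.

NO new real-side estimate (bookkeeping over three landed theorems); 0 sorry; standard axioms; no instances / notation / `#eval`.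
`--supports stmt-AtomisticToContinuum-27623`.
-/

noncomputable section

namespace Summit.AtomisticToContinuum.Crystallization.Theorems.FrustratedLawDichotomyStrainedPatchHomEntryFitHcpConeLeaf

open scoped BigOperators RealInnerProductSpace
open Literature.Analysis.ValidatedNumerics.Numerics
open Summit.AtomisticToContinuum.Crystallization.Theorems.ChargedEnergyGapNegative (E3)
open Summit.AtomisticToContinuum.Crystallization.Theorems.FrustratedLawDichotomyStrainedPatchHomEntryHcpFrame
open Summit.AtomisticToContinuum.Crystallization.Theorems.FrustratedLawDichotomyStrainedPatchHomEntryLeafHT (HcpLeafGoal)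
open Summit.AtomisticToContinuum.Crystallization.Theorems.FrustratedLawDichotomyStrainedPatchHomParamTransfer (HcpFitCoreRobust hcpLeafGoal_of_cone_collar
  norm_apply_le_of_coord_sq smul_clm_apply)
open Summit.AtomisticToContinuum.Crystallization.Theorems.FrustratedLawDichotomyStrainedPatchHomEntryFitHcpKit (dEnclH)
open Summit.AtomisticToContinuum.Crystallization.Theorems.FrustratedLawDichotomyStrainedPatchHomEntryFitHcpCentred (fitOKHDCRSρ fitOKHDCRSρ_sound)
open Summit.AtomisticToContinuum.Crystallization.Theorems.FrustratedLawDichotomyStrainedPatchHomEntrySemanticQuot (semOKHQ semOKHQ_of_sound)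
open Summit.AtomisticToContinuum.Crystallization.Theorems.FrustratedLawDichotomyStrainedPatchHomEntryFitHcpFatLeaf (uContained xiDelta xiCollarOK fatCellOK
  clamp_spec)

/-! ## §1. The Boolean leaf -/

/-- (i) cone `U`-containment at dilation `s = sN/sD`: the nine entry intervals of the cell `(c, w)` shrunk by `s⁻¹` lie inside those of the thin box
`(c₀, w₀)` — `sN·(c₀ − w₀) ≤ sD·(c − w)` and `sD·(c + w) ≤ sN·(c₀ + w₀)`. -/
def uConeContained (sN sD : ℤ) (c₀ w₀ c w : (Fin 3 × Fin 3) ⊕ Fin 3 → ℤ) : Bool :=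
  (List.finRange 3).all fun a => (List.finRange 3).all fun b =>
    decide (sN * (c₀ (Sum.inl (a, b)) - w₀ (Sum.inl (a, b))) ≤ sD * (c (Sum.inl (a, b)) - w (Sum.inl (a, b)))) &&
      decide (sD * (c (Sum.inl (a, b)) + w (Sum.inl (a, b))) ≤ sN * (c₀ (Sum.inl (a, b)) + w₀ (Sum.inl (a, b))))

/-- (ii) the DILATED ξ-collar test: thin shuffle half-widths `≥ 0` and `25·sD²·Σᵢ Δᵢ² ≤ 16·sN²·ρS²` (i.e. `(5/4)·√(Σ Δᵢ²) ≤ s·ρS`). -/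
def xiConeCollarOK (sN sD : ℤ) (c₀ w₀ : (Fin 3 × Fin 3) ⊕ Fin 3 → ℤ) (ρS : ℤ) (c w : (Fin 3 × Fin 3) ⊕ Fin 3 → ℤ) : Bool :=
  ((List.finRange 3).all fun i => decide (0 ≤ w₀ (Sum.inr i))) &&
    decide (25 * sD ^ 2 * ∑ i : Fin 3, xiDelta c₀ w₀ c w i ^ 2 ≤ 16 * sN ^ 2 * ρS ^ 2)

/-- (iii) the dilation range test: `0 < sD ≤ sN` (`s ≥ 1`) and `2·sN·(hi + ρS) ≤ 3·SC·sD` (`s·(d_hi + ρ) ≤ 3/2`), `hi` the thin box's upper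
distance enclosure `(dEnclH c₀ w₀).hi`. -/
def coneDilationOK (sN sD hi ρS : ℤ) : Bool :=
  decide (0 < sD) && decide (sD ≤ sN) && decide (2 * sN * (hi + ρS) ≤ 3 * SC * sD)

/-- The CHEAP per-cell part of the cone leaf (no thin certificate): dilation range ∧ cone `U`-containment ∧ dilated ξ-collar. -/
def coneCellOK (c₀ w₀ : (Fin 3 × Fin 3) ⊕ Fin 3 → ℤ) (ρS hi sN sD : ℤ) (c w : (Fin 3 × Fin 3) ⊕ Fin 3 → ℤ) : Bool :=
  coneDilationOK sN sD hi ρS && uConeContained sN sD c₀ w₀ c w && xiConeCollarOK sN sD c₀ w₀ ρS c w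

/-- ★ **THE CONE LEAF** `coneLeafOK c₀ w₀ q ρS e0S sN sD c w`: the cheap cone cell test at `hi := (dEnclH c₀ w₀).hi` ∧ the robust thin-box
certificate `fitOKHDCRSρ c₀ w₀ q ρS e0S`.  Computable; one `decide` per leaf. -/
def coneLeafOK (c₀ w₀ : (Fin 3 × Fin 3) ⊕ Fin 3 → ℤ) (q : Fin 4 → ℤ) (ρS e0S sN sD : ℤ) (c w : (Fin 3 × Fin 3) ⊕ Fin 3 → ℤ) : Bool :=
  coneCellOK c₀ w₀ ρS (dEnclH c₀ w₀).hi sN sD c w && fitOKHDCRSρ c₀ w₀ q ρS e0S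

/-! ## §2. Real consequences of the integer tests -/

/-- Reading `uConeContained`. [formal bookkeeping] -/
theorem uConeContained_spec {sN sD : ℤ} {c₀ w₀ c w : (Fin 3 × Fin 3) ⊕ Fin 3 → ℤ} (h : uConeContained sN sD c₀ w₀ c w = true)
    (ab : Fin 3 × Fin 3) :
    sN * (c₀ (Sum.inl ab) - w₀ (Sum.inl ab)) ≤ sD * (c (Sum.inl ab) - w (Sum.inl ab)) ∧
      sD * (c (Sum.inl ab) + w (Sum.inl ab)) ≤ sN * (c₀ (Sum.inl ab) + w₀ (Sum.inl ab)) := by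
  obtain ⟨a, b⟩ := ab
  simp only [uConeContained, List.all_eq_true, List.mem_finRange, true_implies, Bool.and_eq_true, decide_eq_true_eq] at h
  exact h a b

/-- Reading `coneDilationOK`. [formal bookkeeping] -/
theorem coneDilationOK_spec {sN sD hi ρS : ℤ} (h : coneDilationOK sN sD hi ρS = true) :
    0 < sD ∧ sD ≤ sN ∧ 2 * sN * (hi + ρS) ≤ 3 * SC * sD := by
  simp only [coneDilationOK, Bool.and_eq_true, decide_eq_true_eq] at h
  exact ⟨h.1.1, h.1.2, h.2⟩

/-- Reading `xiConeCollarOK` over the reals. [formal bookkeeping] -/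
theorem xiConeCollarOK_spec {sN sD : ℤ} {c₀ w₀ c w : (Fin 3 × Fin 3) ⊕ Fin 3 → ℤ} {ρS : ℤ} (h : xiConeCollarOK sN sD c₀ w₀ ρS c w = true) :
    (∀ i : Fin 3, (0 : ℤ) ≤ w₀ (Sum.inr i)) ∧
      25 * ((sD : ℤ) : ℝ) ^ 2 * ∑ i : Fin 3, ((xiDelta c₀ w₀ c w i : ℤ) : ℝ) ^ 2 ≤ 16 * ((sN : ℤ) : ℝ) ^ 2 * ((ρS : ℤ) : ℝ) ^ 2 := by
  simp only [xiConeCollarOK, List.all_eq_true, List.mem_finRange, true_implies, Bool.and_eq_true, decide_eq_true_eq] at h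
  refine ⟨h.1, ?_⟩
  have := h.2
  exact_mod_cast this

/-- A cone-contained entry interval transfers box membership of an entry to the `s⁻¹`-shrunk entry (`s = sN/sD`, `0 < sD`, `0 < sN`). [arithmetic] -/
theorem abs_le_of_coneContained {x : ℝ} {c w c₀ w₀ sN sD : ℤ} (hsD : 0 < sD) (hsN : 0 < sN)
    (hx : |x - (c : ℝ) / SC| ≤ (w : ℝ) / SC) (h1 : sN * (c₀ - w₀) ≤ sD * (c - w)) (h2 : sD * (c + w) ≤ sN * (c₀ + w₀)) :
    |((sD : ℝ) / sN) * x - (c₀ : ℝ) / SC| ≤ (w₀ : ℝ) / SC := by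
  have hS : (0 : ℝ) < SC := SC_pos
  have hD : (0 : ℝ) < sD := by exact_mod_cast hsD
  have hN : (0 : ℝ) < sN := by exact_mod_cast hsN
  have h1' : (sN : ℝ) * (c₀ - w₀) ≤ sD * (c - w) := by exact_mod_cast h1
  have h2' : (sD : ℝ) * (c + w) ≤ sN * (c₀ + w₀) := by exact_mod_cast h2
  rw [abs_le] at hx
  obtain ⟨hxl, hxr⟩ := hx
  have hxl' : (c : ℝ) - w ≤ x * SC := by
    rw [← div_le_iff₀ hS, sub_div]; linarith
  have hxr' : x * SC ≤ (c : ℝ) + w := by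
    rw [← le_div_iff₀ hS, add_div]; linarith
  have key_lo : (sN : ℝ) * (c₀ - w₀) ≤ sD * (x * SC) := h1'.trans (mul_le_mul_of_nonneg_left hxl' hD.le)
  have key_hi : (sD : ℝ) * (x * SC) ≤ sN * (c₀ + w₀) := (mul_le_mul_of_nonneg_left hxr' hD.le).trans h2'
  have hmul : (sD : ℝ) / sN * x * SC = sD * (x * SC) / sN := by ring
  have A : ((c₀ : ℝ) - w₀) / SC ≤ (sD : ℝ) / sN * x := by
    rw [div_le_iff₀ hS, hmul, le_div_iff₀ hN]; linarith
  have B : (sD : ℝ) / sN * x ≤ ((c₀ : ℝ) + w₀) / SC := by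
    rw [le_div_iff₀ hS, hmul, div_le_iff₀ hN]; linarith
  rw [sub_div] at A
  rw [add_div] at B
  rw [abs_le]
  constructor <;> linarith

/-- ★ **THE CLAMP INTO THE THIN SHUFFLE BOX** (the fat leaf's `clamp_spec`, packaged): for `ξ'` in the cell's shuffle box and nonnegative thin shuffle
half-widths, the coordinatewise clamp `ξ` of `ξ'` lies in the thin shuffle box and `Σᵢ (ξ' − ξ)ᵢ² ≤ (Σᵢ Δᵢ²)/SC²`. [arithmetic] -/
theorem exists_clamp_near {c₀ w₀ c w : (Fin 3 × Fin 3) ⊕ Fin 3 → ℤ} (hw₀ : ∀ i : Fin 3, (0 : ℤ) ≤ w₀ (Sum.inr i)) {ξ' : E3}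
    (hξb : ∀ i : Fin 3, |ξ' i - (c (Sum.inr i) : ℝ) / SC| ≤ (w (Sum.inr i) : ℝ) / SC) :
    ∃ ξ : E3, (∀ i : Fin 3, |ξ i - (c₀ (Sum.inr i) : ℝ) / SC| ≤ (w₀ (Sum.inr i) : ℝ) / SC) ∧
      ∑ i, ((ξ' - ξ) i) ^ 2 ≤ (∑ i : Fin 3, ((xiDelta c₀ w₀ c w i : ℤ) : ℝ) ^ 2) / SC ^ 2 := by
  have hS : (0 : ℝ) < SC := SC_pos
  set t : Fin 3 → ℝ := fun i =>
    max ((c₀ (Sum.inr i) : ℝ) / SC - (w₀ (Sum.inr i) : ℝ) / SC)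
      (min ((c₀ (Sum.inr i) : ℝ) / SC + (w₀ (Sum.inr i) : ℝ) / SC) (ξ' i)) with ht
  set ξ : E3 := (EuclideanSpace.equiv (Fin 3) ℝ).symm t with hξdef
  have hξi : ∀ i : Fin 3, ξ i = t i := fun i => rfl
  have hcl : ∀ i : Fin 3, |ξ i - (c₀ (Sum.inr i) : ℝ) / SC| ≤ (w₀ (Sum.inr i) : ℝ) / SC ∧
      |ξ' i - ξ i| ≤ ((xiDelta c₀ w₀ c w i : ℤ) : ℝ) / SC := by
    intro i
    have hw₀' : (0 : ℝ) ≤ (w₀ (Sum.inr i) : ℝ) / SC := div_nonneg (by exact_mod_cast hw₀ i) hS.le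
    have hcs := clamp_spec (c₀ := (c₀ (Sum.inr i) : ℝ) / SC) (hξb i) hw₀'
    rw [hξi i]
    refine ⟨hcs.1, hcs.2.trans (max_le ?_ ?_)⟩
    · exact div_nonneg (by exact_mod_cast (le_max_left 0 _ : (0 : ℤ) ≤ xiDelta c₀ w₀ c w i)) hS.le
    · have hD1 : (|(c (Sum.inr i) : ℝ) - c₀ (Sum.inr i)| + w (Sum.inr i) - w₀ (Sum.inr i) : ℝ) ≤ ((xiDelta c₀ w₀ c w i : ℤ) : ℝ) := by
        have := (le_max_right 0 _ : |c (Sum.inr i) - c₀ (Sum.inr i)| + w (Sum.inr i) - w₀ (Sum.inr i) ≤ xiDelta c₀ w₀ c w i)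
        have := (Int.cast_le (R := ℝ)).2 this
        push_cast [xiDelta] at this ⊢
        exact this
      have := div_le_div_of_nonneg_right hD1 hS.le
      calc |(c (Sum.inr i) : ℝ) / SC - (c₀ (Sum.inr i) : ℝ) / SC| + (w (Sum.inr i) : ℝ) / SC - (w₀ (Sum.inr i) : ℝ) / SC
          = (|(c (Sum.inr i) : ℝ) - c₀ (Sum.inr i)| + w (Sum.inr i) - w₀ (Sum.inr i)) / SC := by
            rw [← sub_div, abs_div, abs_of_pos hS]; ring
        _ ≤ _ := this
  refine ⟨ξ, fun i => (hcl i).1, ?_⟩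
  have hterm : ∀ i : Fin 3, ((ξ' - ξ) i) ^ 2 ≤ (((xiDelta c₀ w₀ c w i : ℤ) : ℝ) / SC) ^ 2 := by
    intro i
    have h2 : |(ξ' - ξ) i| ≤ ((xiDelta c₀ w₀ c w i : ℤ) : ℝ) / SC := by simpa using (hcl i).2
    obtain ⟨hl, hr⟩ := abs_le.1 h2
    exact sq_le_sq' hl hr
  calc ∑ i, ((ξ' - ξ) i) ^ 2 ≤ ∑ i : Fin 3, (((xiDelta c₀ w₀ c w i : ℤ) : ℝ) / SC) ^ 2 := Finset.sum_le_sum fun i _ => hterm i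
    _ = (∑ i : Fin 3, ((xiDelta c₀ w₀ c w i : ℤ) : ℝ) ^ 2) / SC ^ 2 := by
        rw [Finset.sum_div]; exact Finset.sum_congr rfl fun i _ => by ring

/-- A scalar multiple of a self-adjoint operator of `E3` is self-adjoint. [formal bookkeeping] -/
theorem selfAdjoint_smul {U : E3 →L[ℝ] E3} (hsa : ∀ v v' : E3, ⟪U v, v'⟫ = ⟪v, U v'⟫) (r : ℝ) (v v' : E3) :
    ⟪(r • U) v, v'⟫ = ⟪v, (r • U) v'⟫ := by
  simp only [smul_clm_apply, real_inner_smul_left, real_inner_smul_right, hsa]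

/-- Coordinates of the `s⁻¹`-shrunk operator: `((r • U) e_b)_a = r · (U e_b)_a`. [formal bookkeeping] -/
theorem smul_entry (r : ℝ) (U : E3 →L[ℝ] E3) (ab : Fin 3 × Fin 3) :
    ((r • U) (EuclideanSpace.single ab.2 (1 : ℝ))) ab.1 = r * (U (EuclideanSpace.single ab.2 (1 : ℝ))) ab.1 := by
  rw [smul_clm_apply, PiLp.smul_apply, smul_eq_mul]

/-! ## §3. ★★ Soundness: the cone leaf certifies its cell in the quotient currency -/

/-- ★★ The `hver`-shape core: a cone-cell verdict over a valid thin certificate gives the hcp leaf goal at every admissible `(U', ξ')` of the cell, at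
every level — `hcpLeafGoal_of_cone_collar` at the base `s⁻¹ • U'` and the clamp of `ξ'`. [bookkeeping over `fitOKHDCRSρ_sound` + `hcpLeafGoal_of_cone_collar`] -/
theorem hcpLeafGoal_of_coneCellOK {c₀ w₀ c w : (Fin 3 × Fin 3) ⊕ Fin 3 → ℤ} {q : Fin 4 → ℤ} {ρS e0S sN sD : ℤ}
    (hcell : coneCellOK c₀ w₀ ρS (dEnclH c₀ w₀).hi sN sD c w = true) (hfit : fitOKHDCRSρ c₀ w₀ q ρS e0S = true)
    (U' : E3 →L[ℝ] E3) (ξ' : E3) (hsa : ∀ v v' : E3, ⟪U' v, v'⟫ = ⟪v, U' v'⟫) (hU' : ‖U' - 1‖ ≤ 1 / 4) (hξ' : ‖ξ'‖ ≤ 1 / 4)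
    (hbox : ∀ ab : Fin 3 × Fin 3, |(U' (EuclideanSpace.single ab.2 (1 : ℝ))) ab.1 - (c (Sum.inl ab) : ℝ) / SC| ≤ (w (Sum.inl ab) : ℝ) / SC)
    (hξb : ∀ i : Fin 3, |ξ' i - (c (Sum.inr i) : ℝ) / SC| ≤ (w (Sum.inr i) : ℝ) / SC) (μ : ℤ) : HcpLeafGoal μ U' ξ' := by
  simp only [coneCellOK, Bool.and_eq_true] at hcell
  obtain ⟨⟨hdil, hUc⟩, hcol⟩ := hcell
  obtain ⟨hsD, hsDN, hrange⟩ := coneDilationOK_spec hdil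
  obtain ⟨hw₀, hbud⟩ := xiConeCollarOK_spec hcol
  have hS : (0 : ℝ) < SC := SC_pos
  have hsN : 0 < sN := lt_of_lt_of_le hsD hsDN
  have hD : (0 : ℝ) < sD := by exact_mod_cast hsD
  have hN : (0 : ℝ) < sN := by exact_mod_cast hsN
  have hDN : (sD : ℝ) ≤ sN := by exact_mod_cast hsDN
  -- the dilation `s = sN/sD ≥ 1` and the base operator `U := s⁻¹ • U'`
  set s : ℝ := (sN : ℝ) / sD with hs_def
  have hs1 : 1 ≤ s := by rw [hs_def, le_div_iff₀ hD, one_mul]; exact hDN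
  have hs0 : 0 < s := by linarith
  have hsinv : s⁻¹ = (sD : ℝ) / sN := by rw [hs_def, inv_div]
  set U : E3 →L[ℝ] E3 := s⁻¹ • U' with hU_def
  have hUU : s • U = U' := by rw [hU_def, smul_smul, mul_inv_cancel₀ hs0.ne', one_smul]
  have hsaU : ∀ v v' : E3, ⟪U v, v'⟫ = ⟪v, U v'⟫ := selfAdjoint_smul hsa s⁻¹
  -- `U` lies in the thin `U`-box
  have hbox₀ : ∀ ab : Fin 3 × Fin 3,
      |(U (EuclideanSpace.single ab.2 (1 : ℝ))) ab.1 - (c₀ (Sum.inl ab) : ℝ) / SC| ≤ (w₀ (Sum.inl ab) : ℝ) / SC := fun ab => by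
    rw [hU_def, smul_entry, hsinv]
    exact abs_le_of_coneContained hsD hsN (hbox ab) (uConeContained_spec hUc ab).1 (uConeContained_spec hUc ab).2
  -- the clamp of `ξ'` into the thin shuffle box and the robust package there
  obtain ⟨ξ, hξT, hnear⟩ := exists_clamp_near hw₀ hξb
  obtain ⟨-, R, hR⟩ := fitOKHDCRSρ_sound hfit U ξ hsaU hbox₀ hξT
  have hR' : HcpFitCoreRobust U ξ R (4999 / 100000) (((dEnclH c₀ w₀).lo : ℝ) / SC) (((dEnclH c₀ w₀).hi : ℝ) / SC) ((ρS : ℝ) / SC)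
      ((e0S : ℝ) / SC) := hR
  have hρS0 : (0 : ℝ) ≤ ρS := by
    have h0 : (0 : ℝ) ≤ (ρS : ℝ) / SC := hR'.hρ0
    have h1 : (0 : ℝ) ≤ (ρS : ℝ) / SC * SC := mul_nonneg h0 hS.le
    rwa [div_mul_cancel₀ _ (ne_of_gt hS)] at h1
  -- (iii) the dilation range `s·(d_hi + ρ) ≤ 3/2`
  have hdhi' : s * ((((dEnclH c₀ w₀).hi : ℤ) : ℝ) / SC + (ρS : ℝ) / SC) ≤ 3 / 2 := by
    have hr : (2 : ℝ) * sN * ((((dEnclH c₀ w₀).hi : ℤ) : ℝ) + ρS) ≤ 3 * SC * sD := by exact_mod_cast hrange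
    rw [hs_def, ← add_div, div_mul_div_comm, div_le_iff₀ (mul_pos hD hS)]
    linarith
  -- (ii) the dilated collar `‖U' (ξ' − ξ)‖ ≤ s·ρ`
  set m : ℝ := Real.sqrt (∑ i : Fin 3, ((xiDelta c₀ w₀ c w i : ℤ) : ℝ) ^ 2) / SC with hm
  have hsum0 : 0 ≤ ∑ i : Fin 3, ((xiDelta c₀ w₀ c w i : ℤ) : ℝ) ^ 2 := Finset.sum_nonneg fun i _ => sq_nonneg _
  have hm0 : 0 ≤ m := div_nonneg (Real.sqrt_nonneg _) hS.le
  have hnear' : ∑ i, ((ξ' - ξ) i) ^ 2 ≤ m ^ 2 := by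
    rw [hm, div_pow, Real.sq_sqrt hsum0]; exact hnear
  have hρ' : ‖(s • U) (ξ' - ξ)‖ ≤ s * ((ρS : ℝ) / SC) := by
    rw [hUU]
    have h1 : ‖U' (ξ' - ξ)‖ ≤ (1 + 1 / 4) * m := norm_apply_le_of_coord_sq hU' hm0 hnear'
    -- `25·sD²·Σ ≤ 16·sN²·ρS²` ⟹ `(5/4)·√Σ·sD ≤ sN·ρS`
    have hsq : ((5 / 4 : ℝ) * Real.sqrt (∑ i : Fin 3, ((xiDelta c₀ w₀ c w i : ℤ) : ℝ) ^ 2) * sD) ^ 2 ≤ ((sN : ℝ) * ρS) ^ 2 := by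
      rw [mul_pow, mul_pow, Real.sq_sqrt hsum0]; nlinarith [hbud]
    have h54 : (5 / 4 : ℝ) * Real.sqrt (∑ i : Fin 3, ((xiDelta c₀ w₀ c w i : ℤ) : ℝ) ^ 2) * sD ≤ (sN : ℝ) * ρS :=
      (abs_le_of_sq_le_sq' hsq (mul_nonneg hN.le hρS0)).2
    have h2 : (1 + 1 / 4) * m ≤ s * ((ρS : ℝ) / SC) := by
      rw [hm, hs_def, div_mul_div_comm, le_div_iff₀ (mul_pos hD hS)]
      calc (1 + 1 / 4) * (Real.sqrt (∑ i : Fin 3, ((xiDelta c₀ w₀ c w i : ℤ) : ℝ) ^ 2) / SC) * (sD * SC)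
          = (5 / 4 : ℝ) * Real.sqrt (∑ i : Fin 3, ((xiDelta c₀ w₀ c w i : ℤ) : ℝ) ^ 2) * sD := by field_simp; ring
        _ ≤ (sN : ℝ) * ρS := h54
    exact h1.trans h2
  have hU'w : ‖s • U - 1‖ ≤ 1 / 4 := by rw [hUU]; exact hU'
  have hξ'2 : ‖ξ'‖ ≤ 1 / 2 := hξ'.trans (by norm_num)
  have := hcpLeafGoal_of_cone_collar hR' hs1 hdhi' hρ' hU'w hξ'2 μ
  rwa [hUU] at this

/-- ★ The cone LEAF gives the hcp leaf goal on its cell (the `hver` shape of `semOKHQ_of_sound`). [formal bookkeeping] -/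
theorem hcpLeafGoal_of_coneLeafOK {c₀ w₀ c w : (Fin 3 × Fin 3) ⊕ Fin 3 → ℤ} {q : Fin 4 → ℤ} {ρS e0S sN sD : ℤ}
    (h : coneLeafOK c₀ w₀ q ρS e0S sN sD c w = true) (U' : E3 →L[ℝ] E3) (ξ' : E3) (hsa : ∀ v v' : E3, ⟪U' v, v'⟫ = ⟪v, U' v'⟫)
    (hU' : ‖U' - 1‖ ≤ 1 / 4) (hξ' : ‖ξ'‖ ≤ 1 / 4)
    (hbox : ∀ ab : Fin 3 × Fin 3, |(U' (EuclideanSpace.single ab.2 (1 : ℝ))) ab.1 - (c (Sum.inl ab) : ℝ) / SC| ≤ (w (Sum.inl ab) : ℝ) / SC)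
    (hξb : ∀ i : Fin 3, |ξ' i - (c (Sum.inr i) : ℝ) / SC| ≤ (w (Sum.inr i) : ℝ) / SC) (μ : ℤ) : HcpLeafGoal μ U' ξ' := by
  simp only [coneLeafOK, Bool.and_eq_true] at h
  exact hcpLeafGoal_of_coneCellOK h.1 h.2 U' ξ' hsa hU' hξ' hbox hξb μ

/-- ★★ **SOUNDNESS IN THE QUOTIENT CURRENCY**: a cell accepted by the cone leaf is a `semOKHQ` fact at every level `μ`. [formal bookkeeping] -/
theorem semOKHQ_of_coneLeafOK {μ : ℤ} {c₀ w₀ c w : (Fin 3 × Fin 3) ⊕ Fin 3 → ℤ} {q : Fin 4 → ℤ} {ρS e0S sN sD : ℤ}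
    (h : coneLeafOK c₀ w₀ q ρS e0S sN sD c w = true) : semOKHQ μ c w = true :=
  semOKHQ_of_sound (coneLeafOK c₀ w₀ q ρS e0S sN sD)
    (fun _ _ hv U ξ hsa _ hU hξ hbox hξb _ _ => hcpLeafGoal_of_coneLeafOK hv U ξ hsa hU hξ hbox hξb μ) h

/-! ## §4. ONE thin certificate, MANY cheap cone cells (the thin certificate and `dEnclH` evaluated ONCE) -/

/-- ★ **ONE THIN CERTIFICATE + A LIST OF CHEAP CONE CELLS** `(sN, sD, c, w)`: `fitOKHDCRSρ c₀ w₀ q ρS e0S` evaluated ONCE, `hi := (dEnclH c₀ w₀).hi`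
computed ONCE, then `coneCellOK` on every listed cell. -/
def coneLeavesOK (c₀ w₀ : (Fin 3 × Fin 3) ⊕ Fin 3 → ℤ) (q : Fin 4 → ℤ) (ρS e0S : ℤ)
    (L : List (ℤ × ℤ × ((Fin 3 × Fin 3) ⊕ Fin 3 → ℤ) × ((Fin 3 × Fin 3) ⊕ Fin 3 → ℤ))) : Bool :=
  let hi := (dEnclH c₀ w₀).hi
  fitOKHDCRSρ c₀ w₀ q ρS e0S && L.all fun b => coneCellOK c₀ w₀ ρS hi b.1 b.2.1 b.2.2.1 b.2.2.2

/-- The cone leaf from its two parts. [formal bookkeeping] -/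
theorem coneLeafOK_of_parts {c₀ w₀ c w : (Fin 3 × Fin 3) ⊕ Fin 3 → ℤ} {q : Fin 4 → ℤ} {ρS e0S sN sD : ℤ}
    (hcert : fitOKHDCRSρ c₀ w₀ q ρS e0S = true) (hcell : coneCellOK c₀ w₀ ρS (dEnclH c₀ w₀).hi sN sD c w = true) :
    coneLeafOK c₀ w₀ q ρS e0S sN sD c w = true := by
  simp only [coneLeafOK, Bool.and_eq_true]
  exact ⟨hcell, hcert⟩

/-- ★★ **A WHOLE LIST OF CONE CELLS OVER ONE THIN CERTIFICATE**: `coneLeavesOK … L = true` (ONE `decide`, kernel cost ≈ one thin certificate + a few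
comparisons per cell) ⟹ every listed cell `(sN, sD, c, w)` is a `semOKHQ` fact on `(c, w)` at every level. [formal bookkeeping] -/
theorem semFactsQ_of_coneLeavesOK {μ : ℤ} {c₀ w₀ : (Fin 3 × Fin 3) ⊕ Fin 3 → ℤ} {q : Fin 4 → ℤ} {ρS e0S : ℤ}
    {L : List (ℤ × ℤ × ((Fin 3 × Fin 3) ⊕ Fin 3 → ℤ) × ((Fin 3 × Fin 3) ⊕ Fin 3 → ℤ))}
    (h : coneLeavesOK c₀ w₀ q ρS e0S L = true) : ∀ b ∈ L, semOKHQ μ b.2.2.1 b.2.2.2 = true := by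
  simp only [coneLeavesOK, Bool.and_eq_true] at h
  exact fun b hb => semOKHQ_of_coneLeafOK (coneLeafOK_of_parts h.1 (List.all_eq_true.1 h.2 b hb))

/-- The same list read as facts on the `(c, w)` projections (the shape `…HomCutTreeFacts.facts_of_all_sound` consumes). [formal bookkeeping] -/
theorem semFactsQ_of_coneLeavesOK_map {μ : ℤ} {c₀ w₀ : (Fin 3 × Fin 3) ⊕ Fin 3 → ℤ} {q : Fin 4 → ℤ} {ρS e0S : ℤ}
    {L : List (ℤ × ℤ × ((Fin 3 × Fin 3) ⊕ Fin 3 → ℤ) × ((Fin 3 × Fin 3) ⊕ Fin 3 → ℤ))}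
    (h : coneLeavesOK c₀ w₀ q ρS e0S L = true) : ∀ b ∈ L.map fun b => b.2.2, semOKHQ μ b.1 b.2 = true := by
  intro b hb
  obtain ⟨a, ha, rfl⟩ := List.mem_map.1 hb
  exact semFactsQ_of_coneLeavesOK h a ha

/-! ## §5. The fat leaf is the `s = 1` slice -/

/-- At `sN = sD = 1` cone `U`-containment IS the fat leaf's `uContained`. [formal bookkeeping] -/
theorem uConeContained_one_one (c₀ w₀ c w : (Fin 3 × Fin 3) ⊕ Fin 3 → ℤ) : uConeContained 1 1 c₀ w₀ c w = uContained c₀ w₀ c w := by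
  simp only [uConeContained, uContained, one_mul]

/-- At `sN = sD = 1` the dilated ξ-collar IS the fat leaf's `xiCollarOK`. [formal bookkeeping] -/
theorem xiConeCollarOK_one_one (c₀ w₀ : (Fin 3 × Fin 3) ⊕ Fin 3 → ℤ) (ρS : ℤ) (c w : (Fin 3 × Fin 3) ⊕ Fin 3 → ℤ) :
    xiConeCollarOK 1 1 c₀ w₀ ρS c w = xiCollarOK c₀ w₀ ρS c w := by
  simp only [xiConeCollarOK, xiCollarOK, one_pow, mul_one]

/-- ★ At `sN = sD = 1` the cone cell test is the fat cell test plus the (certificate-implied) range check `2(hi + ρS) ≤ 3·SC`: the fat leaf is the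
`s = 1` slice of the cone leaf. [formal bookkeeping] -/
theorem coneCellOK_one_one_iff (c₀ w₀ : (Fin 3 × Fin 3) ⊕ Fin 3 → ℤ) (ρS hi : ℤ) (c w : (Fin 3 × Fin 3) ⊕ Fin 3 → ℤ) :
    coneCellOK c₀ w₀ ρS hi 1 1 c w = true ↔ 2 * (hi + ρS) ≤ 3 * SC ∧ fatCellOK c₀ w₀ ρS c w = true := by
  simp only [coneCellOK, coneDilationOK, fatCellOK, uConeContained_one_one, xiConeCollarOK_one_one, Bool.and_eq_true, decide_eq_true_eq,
    zero_lt_one, le_refl, true_and, mul_one]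
  constructor
  · rintro ⟨⟨h1, h2⟩, h3⟩; exact ⟨by linarith, h2, h3⟩
  · rintro ⟨h1, h2, h3⟩; exact ⟨⟨by linarith, h2⟩, h3⟩

end Summit.AtomisticToContinuum.Crystallization.Theorems.FrustratedLawDichotomyStrainedPatchHomEntryFitHcpConeLeaf

end
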